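import Summits.Ventures.PercRepro.C026TwoCutCount
import Summits.Ventures.PercRepro.C026DCSub

/-!
# mine-3's Theorem B″ for the C-026 slack: a mark-free two-terminal gadget composes exactly (p5, gen 15)

mine-3 (`proofs/MINE3-BLOCKS.md` §5, `proofs/MINE3-TWOCUT.md`, INBOX 16:46Z / 18:46Z): for `G = G₁ ∪ Γ` glued at
the non-marks `s, t` with `Γ` mark-free, `Δ_CF(G) = n00·Δ_CF(G₁) + n10·Δ_CF(G₁ + st) + n11·Δ_CF(G₁/st)`, the
`n_xy` being the gadget's type counts (`x` = open `s`–`t` join, `y` = closed `s`–`t` join; `n01 = n10`). The four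
counts of `Δ_CF` are local events of the marks (`card_twocut`), so the identity is linear bookkeeping
(**`slackCF_twocut`**). Every coefficient is nonnegative: (CF) on `G₁`, `G₁ + st` and `G₁/st` gives (CF) on `G`
(`slackCF_twocut_nonneg`).
-/

namespace PercRepro

open Finset

namespace MultiGraph

section TwoCutCF

variable {V E : Type*} {G : MultiGraph V E}

/-- The cell `ab|c` as a local event. -/
theorem local_cell_ab (a b c : V) :
    Local (fun R _ : V → V → Prop => R a b ∧ ¬ R a c) ({a, b, c} : Set V) := by
  intro R₁ R₂ R₁' R₂' h _
  dsimp only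
  rw [h a (by simp) b (by simp), h a (by simp) c (by simp)]

/-- The cell `ac|b` as a local event. -/
theorem local_cell_ac (a b c : V) :
    Local (fun R _ : V → V → Prop => R c a ∧ ¬ R c b) ({a, b, c} : Set V) := by
  intro R₁ R₂ R₁' R₂' h _
  dsimp only
  rw [h c (by simp) a (by simp), h c (by simp) b (by simp)]

/-- The cell `bc|a` as a local event. -/
theorem local_cell_bc (a b c : V) :
    Local (fun R _ : V → V → Prop => R c b ∧ ¬ R c a) ({a, b, c} : Set V) := by
  intro R₁ R₂ R₁' R₂' h _
  dsimp only
  rw [h c (by simp) b (by simp), h c (by simp) a (by simp)]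

/-- `N_AB` as a local event. -/
theorem local_nAB (a b c : V) :
    Local (fun R R' : V → V → Prop => R a b ∧ ¬ R' c a ∧ ¬ R' c b) ({a, b, c} : Set V) := by
  intro R₁ R₂ R₁' R₂' h h'
  dsimp only
  rw [h a (by simp) b (by simp), h' c (by simp) a (by simp), h' c (by simp) b (by simp)]

open Classical in
/-- **THEOREM B″ for `Δ_CF`**: `Δ_CF(G) = n00·Δ_CF(G₁) + n10·Δ_CF(G₁ + st) + n11·Δ_CF(G₁/st)` for a mark-free
gadget glued at the non-marks `s, t` (`G₁ = G.part side true`, the gadget `G.part side false`). -/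
theorem slackCF_twocut [Fintype E] {s t : V} {side : E → Bool} (hg : G.IsGluing s t t side) (hts : t ≠ s)
    {a b c : V} (ha : a ≠ s ∧ G.OnSide side true a) (hb : b ≠ s ∧ G.OnSide side true b)
    (hc : c ≠ s ∧ G.OnSide side true c) :
    G.slackCF a b c =
      ((univ.filter fun ω₂ : Config {e // side e = false} =>
          G.gadgetJoin₂ side s t ω₂ = false ∧ G.gadgetJoin₂ side s t ω₂ᶜ = false).card : ℤ) *
        (G.part side true).slackCF a b c +
      ((univ.filter fun ω₂ : Config {e // side e = false} =>
          G.gadgetJoin₂ side s t ω₂ = true ∧ G.gadgetJoin₂ side s t ω₂ᶜ = false).card : ℤ) *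
        (G.virt side s t).slackCF a b c +
      ((univ.filter fun ω₂ : Config {e // side e = false} =>
          G.gadgetJoin₂ side s t ω₂ = true ∧ G.gadgetJoin₂ side s t ω₂ᶜ = true).card : ℤ) *
        ((G.part side true).contract s t).slackCF a b c := by
  have hM : ∀ m ∈ ({a, b, c} : Set V), m ≠ s ∧ G.OnSide side true m := by
    intro m hm
    simp only [Set.mem_insert_iff, Set.mem_singleton_iff] at hm
    rcases hm with rfl | rfl | rfl
    · exact ha
    · exact hb
    · exact hc
  have h1 := card_twocut hg hts (fun R _ : V → V → Prop => R a b ∧ ¬ R a c) hM (local_cell_ab a b c)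
  have h2 := card_twocut hg hts (fun R _ : V → V → Prop => R c a ∧ ¬ R c b) hM (local_cell_ac a b c)
  have h3 := card_twocut hg hts (fun R _ : V → V → Prop => R c b ∧ ¬ R c a) hM (local_cell_bc a b c)
  have h4 := card_twocut hg hts (fun R R' : V → V → Prop => R a b ∧ ¬ R' c a ∧ ¬ R' c b) hM
    (local_nAB a b c)
  -- the linear bookkeeping, with the four counts as hypotheses; the instances of the parts' cubes are
  -- subsingletons, absorbed by `convert`
  have key : ∀ (A₁ A₂ A₃ A₄ B₁ B₂ B₃ B₄ C₁ C₂ C₃ C₄ D₁ D₂ D₃ D₄ n₀ n₁ n₂ : ℤ),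
      A₁ = n₀ * B₁ + n₁ * C₁ + n₂ * D₁ → A₂ = n₀ * B₂ + n₁ * C₂ + n₂ * D₂ →
      A₃ = n₀ * B₃ + n₁ * C₃ + n₂ * D₃ → A₄ = n₀ * B₄ + n₁ * C₄ + n₂ * D₄ →
      A₁ + A₂ + A₃ - A₄ =
        n₀ * (B₁ + B₂ + B₃ - B₄) + n₁ * (C₁ + C₂ + C₃ - C₄) + n₂ * (D₁ + D₂ + D₃ - D₄) := by
    intros
    subst_vars
    ring
  unfold slackCF
  refine key _ _ _ _ _ _ _ _ _ _ _ _ _ _ _ _ _ _ _ ?_ ?_ ?_ ?_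
  · have := congrArg (fun n : ℕ => (n : ℤ)) h1
    push_cast at this
    convert this using 9 <;> rfl
  · have := congrArg (fun n : ℕ => (n : ℤ)) h2
    push_cast at this
    convert this using 9 <;> rfl
  · have := congrArg (fun n : ℕ => (n : ℤ)) h3
    push_cast at this
    convert this using 9 <;> rfl
  · have := congrArg (fun n : ℕ => (n : ℤ)) h4
    push_cast at this
    convert this using 9 <;> rfl

open Classical in
/-- **(CF) composes over a mark-free two-terminal gadget**: (CF) on `G₁`, on `G₁ + st` and on `G₁/st` gives
(CF) on `G` (every coefficient of `slackCF_twocut` is a count). -/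
theorem slackCF_twocut_nonneg [Fintype E] {s t : V} {side : E → Bool} (hg : G.IsGluing s t t side)
    (hts : t ≠ s) {a b c : V} (ha : a ≠ s ∧ G.OnSide side true a) (hb : b ≠ s ∧ G.OnSide side true b)
    (hc : c ≠ s ∧ G.OnSide side true c) (h₁ : 0 ≤ (G.part side true).slackCF a b c)
    (h₂ : 0 ≤ (G.virt side s t).slackCF a b c) (h₃ : 0 ≤ ((G.part side true).contract s t).slackCF a b c) :
    0 ≤ G.slackCF a b c := by
  rw [slackCF_twocut hg hts ha hb hc]
  exact add_nonneg (add_nonneg (mul_nonneg (Nat.cast_nonneg _) h₁) (mul_nonneg (Nat.cast_nonneg _) h₂))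
    (mul_nonneg (Nat.cast_nonneg _) h₃)

end TwoCutCF

end MultiGraph

end PercRepro
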